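import Summits.ValiantsHypothesis.ValiantsHypothesis.Cruxes.OrbitDimensionBound.Lines.ChannelLadder

/-! # BC / F3 — the floor is the `ρ = 0` member of the channel family, VERBATIM up to `simp`.
(`Lines.ChannelLadder` = this folder's `Sketch.lean`, published under the crux.) -/

open Summit.ValiantsHypothesis.ValiantsHypothesis.Cruxes.OrbitDimensionBound.Channel
open Summit.ValiantsHypothesis.ValiantsHypothesis.Cruxes.OrbitDimensionBound.Confusion (CoveringShadow powLoss)

/-- Floor member of the NUMERIC family from the seed theorem. -/
example : ChannelCovering 0 := by
  simpa [channelCovering_zero_iff] using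
    Summit.ValiantsHypothesis.ValiantsHypothesis.Theorems.FreeSubtorusSubtorusCovering.subtorusCovering_proof

/-- Floor member of the SHADOW family (the filed rung is `ChannelShadow 1`) from the floor's proved shadow. -/
example : ChannelShadow 0 := by
  simpa [channelShadow_zero_iff] using
    Summit.ValiantsHypothesis.ValiantsHypothesis.Cruxes.OrbitDimensionBound.RowTorus.powShadow_floor

/-- Rung ⇒ floor (shadow currency). -/
example (h : OneChannelShadow) : CoveringShadow powLoss := powShadow_of_oneChannelShadow h
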